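import Literature.NumberTheory.Sieve.SiftedLargeSieveCharacters
import HarnessLib

/-!
# The one-dimensional Selberg square of Maynard's Proposition 9.4 (the extra form `L₀ = L_{k+1}`)

Source: J. Maynard, *Dense clusters of primes in subsets*, Compositio Math. 152 (2016) =
arXiv:1405.2593 [Maynard2016DenseClusters], proof of Proposition 9.4 pp. 25–26: to bound
`∑_{n : L(n) prime > R₀} w_n` for a form `L = L_{k+1} ∉ 𝓛` one multiplies `w_n` by the square of a
one-dimensional Selberg weight `(∑_{d₀ ∣ L(n), d₀ ≤ R₀} λ̃_{d₀})²` with `ỹ ≡ 1` («we take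
`y_{r,r₀} = y_r` for `r₀ ≤ N^ξ`»), which is `≥ λ̃_1² = S₀²` on the targets and costs a factor
`S₀^{-1} ≍ (M/φ(M))/log R₀` — the `Δ_L/φ(Δ_L) · (log R)^{-1}` of (9.4).

This file is the ONE-DIMENSIONAL part (E2b leaf `prop94Z`, spec P94 (1a), (1e)), for a modulus `M`
and a level `R₀`:
* `box₀ M R₀ = {1 ≤ r ≤ R₀ : μ²(r) = 1, (r,M) = 1}`, `S0 = ∑_{r ∈ box₀} 1/φ(r)`,
  `lamT d = μ(d) d ∑_{r ∈ box₀, d∣r} 1/φ(r)` (`lamT 1 = S0`);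
* **`log_le_mul_S0`** — `log R₀ ≤ (M/φ(M)) S0` (= the tree's `LargeSieve.log_le_mul_sum_inv_totient`,
  Bombieri's weight of Théorème 8);
* **`filter_dvd_prime_eq_singleton`**, **`sum_lamT_dvd_prime`**, **`indicator_prime_le`** — for a prime
  `q > R₀` the only `d ∈ box₀` dividing `q` is `1`, so `∑_{d ∣ q} λ̃_d = S0` and
  `1_{q prime, q > R₀} · w ≤ S0^{-2} (∑_{d∈box₀, d∣q} λ̃_d)² · w` (the pointwise majorant);
* `abs_lamT_le`, `sum_abs_lamT_le` — crude `|λ̃_d| ≤ d S0`, `∑ |λ̃_d| ≤ R₀² S0`;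
* **`sum_inv_totient_mul_prod_le`** — the divisor swap of (1e) (NO Mertens):
  `∑_{r∈box₀} φ(r)^{-1} ∏_{p∣r}(1 + g(p)) ≤ S0 · ∏_{p ≤ R₀}(1 + g(p)/(p−1))` for any `g ≥ 0`;
  (for `∏ (1 + f) ≤ exp(∑ f)` use the tree's `SharpGY.prod_one_add_le_exp_sum`,
  `LinearEquationsInPrimesSharpGYCorrelation`).

## References
* J. Maynard, *Dense clusters of primes in subsets*, Compositio Math. 152 (2016), proof of Prop. 9.4
  pp. 25–26 [Maynard2016DenseClusters].
* E. Bombieri, *Le grand crible dans la théorie analytique des nombres*, Astérisque 18 (1987), §3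
  p. 23 [Bombieri1987GrandCrible].
-/

noncomputable section

open Finset
open scoped ArithmeticFunction.Moebius

namespace Literature.NumberTheory.Sieve.SelbergBox

/-! ### The one-dimensional box, `S₀` and `λ̃` -/

/-- `box₀ M R₀ = {1 ≤ r ≤ ⌊R₀⌋ : μ²(r) = 1, (r, M) = 1}` (the support of `ỹ ≡ 1`).
[cite: Maynard2016DenseClusters, proof of Prop. 9.4 p. 25 («r₀ ≤ N^ξ», «(d₀, W_{k+1}) = 1»)] -/
def box₀ (M : ℕ) (R₀ : ℝ) : Finset ℕ :=
  (Finset.Icc 1 ⌊R₀⌋₊).filter fun d => Squarefree d ∧ d.Coprime M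

/-- `S₀ = ∑_{r ∈ box₀} 1/φ(r)` (`= λ̃_1`, the one-dimensional main sum).
[cite: Maynard2016DenseClusters, proof of Prop. 9.4 p. 26 (the sum over r₀); Bombieri1987GrandCrible, §3 p. 23] -/
def S0 (M : ℕ) (R₀ : ℝ) : ℝ := ∑ r ∈ box₀ M R₀, ((Nat.totient r : ℕ) : ℝ)⁻¹

/-- The one-dimensional Selberg weights with `ỹ ≡ 1`: `λ̃_d = μ(d) d ∑_{r ∈ box₀, d ∣ r} 1/φ(r)`.
[cite: Maynard2016DenseClusters, (8.6) p. 14 with y ≡ 1; proof of Prop. 9.4 p. 25] -/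
def lamT (M : ℕ) (R₀ : ℝ) (d : ℕ) : ℝ :=
  ((μ d : ℤ) : ℝ) * (d : ℝ) * ∑ r ∈ (box₀ M R₀).filter (fun r => d ∣ r), ((Nat.totient r : ℕ) : ℝ)⁻¹

section Basic

variable {M : ℕ} {R₀ : ℝ}

/-- Membership in `box₀`. [cite: Maynard2016DenseClusters, proof of Prop. 9.4 p. 25] -/
theorem mem_box₀ {d : ℕ} :
    d ∈ box₀ M R₀ ↔ (1 ≤ d ∧ d ≤ ⌊R₀⌋₊) ∧ Squarefree d ∧ d.Coprime M := by
  unfold box₀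
  rw [Finset.mem_filter, Finset.mem_Icc]

/-- `1 ∈ box₀` once `R₀ ≥ 1`. [cite: Maynard2016DenseClusters, proof of Prop. 9.4 p. 25] -/
theorem one_mem_box₀ (hR : 1 ≤ R₀) : 1 ∈ box₀ M R₀ :=
  mem_box₀.2 ⟨⟨le_rfl, Nat.le_floor (by exact_mod_cast hR)⟩, squarefree_one, Nat.coprime_one_left M⟩

/-- `d ∈ box₀ ⇒ d ≤ R₀`. [cite: Maynard2016DenseClusters, proof of Prop. 9.4 p. 25] -/
theorem le_of_mem_box₀ (hR : 0 ≤ R₀) {d : ℕ} (hd : d ∈ box₀ M R₀) : (d : ℝ) ≤ R₀ :=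
  le_trans (by exact_mod_cast (mem_box₀.1 hd).1.2) (Nat.floor_le hR)

/-- `d ∈ box₀ ⇒ 1 ≤ d`. [cite: Maynard2016DenseClusters, proof of Prop. 9.4 p. 25] -/
theorem one_le_of_mem_box₀ {d : ℕ} (hd : d ∈ box₀ M R₀) : 1 ≤ d := (mem_box₀.1 hd).1.1

/-- `box₀` is divisor-closed. [cite: Maynard2016DenseClusters, proof of Prop. 9.4 p. 25] -/
theorem mem_box₀_of_dvd {r d : ℕ} (hr : r ∈ box₀ M R₀) (hd : d ∣ r) : d ∈ box₀ M R₀ := by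
  obtain ⟨⟨hr1, hrR⟩, hrsq, hrcop⟩ := mem_box₀.1 hr
  have hd0 : d ≠ 0 := fun h0 => by
    rw [h0, zero_dvd_iff] at hd
    exact absurd hd (Nat.one_le_iff_ne_zero.1 hr1)
  exact mem_box₀.2 ⟨⟨Nat.one_le_iff_ne_zero.2 hd0, (Nat.le_of_dvd hr1 hd).trans hrR⟩,
    hrsq.squarefree_of_dvd hd, hrcop.coprime_dvd_left hd⟩

/-- `#box₀ ≤ R₀`. [cite: Maynard2016DenseClusters, proof of Prop. 9.4 p. 25] -/
theorem card_box₀_le (hR : 0 ≤ R₀) : ((box₀ M R₀).card : ℝ) ≤ R₀ := by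
  have h1 : (box₀ M R₀).card ≤ (Finset.Icc 1 ⌊R₀⌋₊).card := Finset.card_filter_le _ _
  rw [Nat.card_Icc, Nat.add_sub_cancel] at h1
  exact le_trans (by exact_mod_cast h1) (Nat.floor_le hR)

/-- `0 ≤ S₀`. [cite: Maynard2016DenseClusters, proof of Prop. 9.4 p. 26] -/
theorem S0_nonneg : 0 ≤ S0 M R₀ :=
  Finset.sum_nonneg fun _ _ => inv_nonneg.2 (Nat.cast_nonneg _)

/-- `1 ≤ S₀` once `R₀ ≥ 1` (the term `r = 1`). [cite: Maynard2016DenseClusters, proof of Prop. 9.4 p. 26] -/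
theorem one_le_S0 (hR : 1 ≤ R₀) : 1 ≤ S0 M R₀ := by
  unfold S0
  have h := Finset.single_le_sum (f := fun r => ((Nat.totient r : ℕ) : ℝ)⁻¹)
    (fun r _ => inv_nonneg.2 (Nat.cast_nonneg _)) (one_mem_box₀ (M := M) hR)
  simpa using h

/-- `λ̃_1 = S₀`. [cite: Maynard2016DenseClusters, proof of Prop. 9.4 p. 26] -/
theorem lamT_one : lamT M R₀ 1 = S0 M R₀ := by
  unfold lamT S0
  rw [ArithmeticFunction.moebius_apply_one, Finset.filter_true_of_mem fun r _ => one_dvd r]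
  push_cast
  ring

/-- **`log R₀ ≤ (M/φ(M)) S₀`** — the one-dimensional main sum is `≫ (φ(M)/M) log R₀`; this is the
tree's `LargeSieve.log_le_mul_sum_inv_totient` (Bombieri's weight of Théorème 8).
[cite: Maynard2016DenseClusters, proof of Prop. 9.4 p. 26 («∑_{r₀<N^ξ,(r₀,W_{k+1})=1} μ²(r₀)/φ(r₀) ≫ φ(W_{k+1})/W_{k+1} · log R»); Bombieri1987GrandCrible, §3 p. 23] -/
theorem log_le_mul_S0 (hM : M ≠ 0) (hR : 0 ≤ R₀) :
    Real.log R₀ ≤ (M : ℝ) / (Nat.totient M) * S0 M R₀ :=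
  LargeSieve.log_le_mul_sum_inv_totient hM hR

/-! ### The pointwise majorant for primes `> R₀` -/

/-- For a prime `q > R₀` (and `R₀ ≥ 1`): `{d ∈ box₀ : d ∣ q} = {1}`.
[cite: Maynard2016DenseClusters, proof of Prop. 9.4 p. 25 («if L(n) is a prime > R then d_{k+1} = 1»)] -/
theorem filter_dvd_prime_eq_singleton (hR : 1 ≤ R₀) {q : ℕ} (hq : q.Prime) (hqR : R₀ < q) :
    (box₀ M R₀).filter (fun d => d ∣ q) = {1} := by
  ext d
  rw [Finset.mem_filter, Finset.mem_singleton]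
  constructor
  · rintro ⟨hd, hdq⟩
    rcases (Nat.dvd_prime hq).1 hdq with h | h
    · exact h
    · exfalso
      have h1 := le_of_mem_box₀ (le_trans zero_le_one hR) hd
      rw [h] at h1
      exact absurd hqR (not_lt.2 h1)
  · rintro rfl
    exact ⟨one_mem_box₀ hR, one_dvd q⟩

/-- For a prime `q > R₀`: `∑_{d ∈ box₀, d ∣ q} λ̃_d = S₀`.
[cite: Maynard2016DenseClusters, proof of Prop. 9.4 p. 25] -/
theorem sum_lamT_dvd_prime (hR : 1 ≤ R₀) {q : ℕ} (hq : q.Prime) (hqR : R₀ < q) :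
    ∑ d ∈ (box₀ M R₀).filter (fun d => d ∣ q), lamT M R₀ d = S0 M R₀ := by
  rw [filter_dvd_prime_eq_singleton hR hq hqR, Finset.sum_singleton, lamT_one]

/-- **The pointwise majorant** (integer values of a linear form): for `w ≥ 0` and `L ∈ ℤ`,
`1_{L > 0, |L| prime, L > R₀} · w ≤ S₀^{-2} · (∑_{d ∈ box₀, d ∣ L} λ̃_d)² · w` (`R₀ ≥ 1`).
[cite: Maynard2016DenseClusters, proof of Prop. 9.4 p. 25 (the weights w̃_n majorise w_n on n with L(n) prime)] -/
theorem indicator_prime_le (hR : 1 ≤ R₀) (L : ℤ) {w : ℝ} (hw : 0 ≤ w) :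
    (if 0 < L ∧ L.natAbs.Prime ∧ R₀ < (L : ℝ) then w else 0) ≤
      (S0 M R₀)⁻¹ ^ 2 * (∑ d ∈ (box₀ M R₀).filter (fun d : ℕ => ((d : ℕ) : ℤ) ∣ L), lamT M R₀ d) ^ 2 * w := by
  have hS : 0 < S0 M R₀ := lt_of_lt_of_le zero_lt_one (one_le_S0 hR)
  split_ifs with h
  · obtain ⟨hL0, hLp, hLR⟩ := h
    have hqR : R₀ < (L.natAbs : ℝ) := by
      have : ((L.natAbs : ℕ) : ℝ) = ((L : ℤ) : ℝ) := by
        rw [← Int.cast_natCast, Int.natAbs_of_nonneg hL0.le]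
      rw [this]; exact hLR
    have hfilt : (box₀ M R₀).filter (fun d : ℕ => ((d : ℕ) : ℤ) ∣ L) =
        (box₀ M R₀).filter (fun d : ℕ => d ∣ L.natAbs) :=
      Finset.filter_congr fun d _ => Int.natCast_dvd
    rw [hfilt, sum_lamT_dvd_prime hR hLp hqR, inv_pow, inv_mul_cancel₀ (pow_ne_zero 2 hS.ne'),
      one_mul]
  · positivity

/-! ### Crude bounds for `λ̃` -/

/-- `|λ̃_d| ≤ d · S₀`. [cite: Maynard2016DenseClusters, (8.6) p. 14 with y ≡ 1] -/
theorem abs_lamT_le (d : ℕ) : |lamT M R₀ d| ≤ (d : ℝ) * S0 M R₀ := by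
  unfold lamT S0
  have hsub : ∑ r ∈ (box₀ M R₀).filter (fun r => d ∣ r), ((Nat.totient r : ℕ) : ℝ)⁻¹ ≤
      ∑ r ∈ box₀ M R₀, ((Nat.totient r : ℕ) : ℝ)⁻¹ :=
    Finset.sum_le_sum_of_subset_of_nonneg (Finset.filter_subset _ _)
      fun r _ _ => inv_nonneg.2 (Nat.cast_nonneg _)
  have hnn : 0 ≤ ∑ r ∈ (box₀ M R₀).filter (fun r => d ∣ r), ((Nat.totient r : ℕ) : ℝ)⁻¹ :=
    Finset.sum_nonneg fun r _ => inv_nonneg.2 (Nat.cast_nonneg _)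
  have hμ : |((μ d : ℤ) : ℝ)| ≤ 1 := by exact_mod_cast ArithmeticFunction.abs_moebius_le_one
  rw [abs_mul, abs_mul, abs_of_nonneg hnn, Nat.abs_cast]
  calc |((μ d : ℤ) : ℝ)| * (d : ℝ) * ∑ r ∈ (box₀ M R₀).filter (fun r => d ∣ r), ((Nat.totient r : ℕ) : ℝ)⁻¹
      ≤ 1 * (d : ℝ) * ∑ r ∈ box₀ M R₀, ((Nat.totient r : ℕ) : ℝ)⁻¹ := by gcongr
    _ = (d : ℝ) * ∑ r ∈ box₀ M R₀, ((Nat.totient r : ℕ) : ℝ)⁻¹ := by ring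

/-- `∑_{d ∈ box₀} |λ̃_d| ≤ R₀² S₀`. [cite: Maynard2016DenseClusters, (8.6) p. 14 with y ≡ 1; proof of Prop. 9.4 p. 25 (error term)] -/
theorem sum_abs_lamT_le (hR : 0 ≤ R₀) :
    ∑ d ∈ box₀ M R₀, |lamT M R₀ d| ≤ R₀ ^ 2 * S0 M R₀ := by
  calc ∑ d ∈ box₀ M R₀, |lamT M R₀ d| ≤ ∑ d ∈ box₀ M R₀, R₀ * S0 M R₀ :=
        Finset.sum_le_sum fun d hd => (abs_lamT_le d).trans
          (mul_le_mul_of_nonneg_right (le_of_mem_box₀ hR hd) S0_nonneg)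
    _ = (box₀ M R₀).card * (R₀ * S0 M R₀) := by rw [Finset.sum_const, nsmul_eq_mul]
    _ ≤ R₀ * (R₀ * S0 M R₀) :=
        mul_le_mul_of_nonneg_right (card_box₀_le hR) (mul_nonneg hR S0_nonneg)
    _ = R₀ ^ 2 * S0 M R₀ := by ring

/-! ### The divisor swap: `∑ φ(r)^{-1} ∏_{p∣r}(1+g(p)) ≤ S₀ ∏_p (1 + g(p)/(p-1))` -/

/-- `φ(∏_{p∈T} p) ≥ ∏_{p∈T} (p−1)` for a set `T` of primes (super-multiplicativity of `φ`).
[cite: Maynard2016DenseClusters, proof of Prop. 9.4 p. 26 (multiplicativity in r₀)] -/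
theorem prod_sub_one_le_totient_prod {T : Finset ℕ} (hT : ∀ p ∈ T, p.Prime) :
    ∏ p ∈ T, (p - 1) ≤ Nat.totient (∏ p ∈ T, p) := by
  classical
  induction T using Finset.induction_on with
  | empty => simp
  | insert p T hpT ih =>
    rw [Finset.prod_insert hpT, Finset.prod_insert hpT]
    have hp : p.Prime := hT p (Finset.mem_insert_self p T)
    have ih' := ih fun q hq => hT q (Finset.mem_insert_of_mem hq)
    calc (p - 1) * ∏ q ∈ T, (q - 1) ≤ Nat.totient p * Nat.totient (∏ q ∈ T, q) := by
          rw [Nat.totient_prime hp]; exact Nat.mul_le_mul_left _ ih'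
      _ ≤ Nat.totient (p * ∏ q ∈ T, q) := Nat.totient_super_multiplicative _ _

/-- **The divisor swap (P94 (1e)), no Mertens needed**: for any `g ≥ 0`,
`∑_{r ∈ box₀} φ(r)^{-1} ∏_{p∣r} (1 + g(p)) ≤ S₀ · ∏_{p ≤ R₀ prime} (1 + g(p)/(p−1))`
(expand `∏(1+g) = ∑_{T ⊆ primes of r} ∏_T g`, swap, `r = e_T r'`, `φ(r) ≥ φ(e_T)φ(r')`, `φ(e_T) ≥ ∏_T (p−1)`).
[cite: Maynard2016DenseClusters, proof of Prop. 9.4 p. 26 (the sum over r₀ with the multiplicative weight from the local factors)] -/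
theorem sum_inv_totient_mul_prod_le (M : ℕ) (R₀ : ℝ) {g : ℕ → ℝ} (hg : ∀ p, 0 ≤ g p) :
    ∑ r ∈ box₀ M R₀, ((Nat.totient r : ℕ) : ℝ)⁻¹ * ∏ p ∈ r.primeFactors, (1 + g p) ≤
      S0 M R₀ * ∏ p ∈ (Finset.range (⌊R₀⌋₊ + 1)).filter Nat.Prime, (1 + g p / ((p : ℝ) - 1)) := by
  classical
  set P := (Finset.range (⌊R₀⌋₊ + 1)).filter Nat.Prime with hP
  set box := box₀ M R₀ with hbox
  have hPprime : ∀ p ∈ P, p.Prime := fun p hp => (Finset.mem_filter.1 hp).2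
  have hpf_sub : ∀ r ∈ box, r.primeFactors ⊆ P := by
    intro r hr p hp
    have hr' := mem_box₀.1 hr
    have hpr := Nat.le_of_dvd hr'.1.1 (Nat.dvd_of_mem_primeFactors hp)
    exact Finset.mem_filter.2 ⟨Finset.mem_range.2 (by have := hr'.1.2; omega),
      Nat.prime_of_mem_primeFactors hp⟩
  have hφpos : ∀ n : ℕ, 1 ≤ n → (0 : ℝ) < ((Nat.totient n : ℕ) : ℝ) := fun n hn => by
    exact_mod_cast Nat.totient_pos.2 hn
  -- Step 1: expand the product over subsets `T ⊆ P`.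
  have hstep1 : ∀ r ∈ box, ((Nat.totient r : ℕ) : ℝ)⁻¹ * ∏ p ∈ r.primeFactors, (1 + g p) =
      ∑ T ∈ P.powerset, (if T ⊆ r.primeFactors then
        ((Nat.totient r : ℕ) : ℝ)⁻¹ * ∏ p ∈ T, g p else 0) := by
    intro r hr
    rw [Finset.prod_one_add, Finset.mul_sum, ← Finset.sum_filter]
    have hset : P.powerset.filter (fun T => T ⊆ r.primeFactors) = r.primeFactors.powerset := by
      ext T
      rw [Finset.mem_filter, Finset.mem_powerset, Finset.mem_powerset]
      exact ⟨fun h => h.2, fun h => ⟨h.trans (hpf_sub r hr), h⟩⟩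
    rw [hset]
  rw [Finset.sum_congr rfl hstep1, Finset.sum_comm]
  -- Step 2: for each `T`, bound the `r`-sum by `(∏_{p∈T} g p/(p-1)) * S0`.
  have hstep2 : ∀ T ∈ P.powerset,
      ∑ r ∈ box, (if T ⊆ r.primeFactors then ((Nat.totient r : ℕ) : ℝ)⁻¹ * ∏ p ∈ T, g p else 0) ≤
        (∏ p ∈ T, g p / ((p : ℝ) - 1)) * S0 M R₀ := by
    intro T hT
    have hTprime : ∀ p ∈ T, p.Prime := fun p hp => hPprime p (Finset.mem_powerset.1 hT hp)
    set e : ℕ := ∏ p ∈ T, p with he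
    have he1 : 1 ≤ e := Nat.one_le_iff_ne_zero.2
      (Finset.prod_ne_zero_iff.2 fun p hp => (hTprime p hp).ne_zero)
    have hφe : (∏ p ∈ T, ((p : ℝ) - 1)) ≤ ((Nat.totient e : ℕ) : ℝ) := by
      have h := prod_sub_one_le_totient_prod hTprime
      have hcast : ((∏ p ∈ T, (p - 1) : ℕ) : ℝ) = ∏ p ∈ T, ((p : ℝ) - 1) := by
        rw [Nat.cast_prod]
        refine Finset.prod_congr rfl fun p hp => ?_
        rw [Nat.cast_sub (hTprime p hp).one_le]; simp
      rw [← hcast]; exact_mod_cast h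
    have hprodpos : (0 : ℝ) < ∏ p ∈ T, ((p : ℝ) - 1) :=
      Finset.prod_pos fun p hp => by
        have := (hTprime p hp).two_le
        have : (2 : ℝ) ≤ p := by exact_mod_cast this
        linarith
    have hgT : 0 ≤ ∏ p ∈ T, g p := Finset.prod_nonneg fun p _ => hg p
    -- the `r` with `T ⊆ primeFactors r` are multiples of `e`; reindex `r ↦ r / e`
    have hsum : ∑ r ∈ box, (if T ⊆ r.primeFactors then ((Nat.totient r : ℕ) : ℝ)⁻¹ * ∏ p ∈ T, g p
        else 0) ≤ (∏ p ∈ T, g p) * (((Nat.totient e : ℕ) : ℝ)⁻¹ * S0 M R₀) := by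
      rw [← Finset.sum_filter]
      have hle : ∀ r ∈ box.filter (fun r => T ⊆ r.primeFactors),
          ((Nat.totient r : ℕ) : ℝ)⁻¹ * ∏ p ∈ T, g p ≤
            (∏ p ∈ T, g p) * (((Nat.totient e : ℕ) : ℝ)⁻¹ * ((Nat.totient (r / e) : ℕ) : ℝ)⁻¹) := by
        intro r hr
        obtain ⟨hrbox, hTr⟩ := Finset.mem_filter.1 hr
        have hr1 := one_le_of_mem_box₀ hrbox
        have her : e ∣ r := Finset.prod_primes_dvd r (fun p hp => (hTprime p hp).prime)
          fun p hp => Nat.dvd_of_mem_primeFactors (hTr hp)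
        have hre1 : 1 ≤ r / e := (Nat.div_pos (Nat.le_of_dvd hr1 her) he1)
        have hmul : ((Nat.totient e : ℕ) : ℝ) * ((Nat.totient (r / e) : ℕ) : ℝ) ≤
            ((Nat.totient r : ℕ) : ℝ) := by
          have h := Nat.totient_super_multiplicative e (r / e)
          rw [Nat.mul_div_cancel' her] at h
          exact_mod_cast h
        have hinv : ((Nat.totient r : ℕ) : ℝ)⁻¹ ≤
            ((Nat.totient e : ℕ) : ℝ)⁻¹ * ((Nat.totient (r / e) : ℕ) : ℝ)⁻¹ := by
          rw [← mul_inv]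
          exact inv_anti₀ (mul_pos (hφpos e he1) (hφpos _ hre1)) hmul
        calc ((Nat.totient r : ℕ) : ℝ)⁻¹ * ∏ p ∈ T, g p
            = (∏ p ∈ T, g p) * ((Nat.totient r : ℕ) : ℝ)⁻¹ := mul_comm _ _
          _ ≤ (∏ p ∈ T, g p) * (((Nat.totient e : ℕ) : ℝ)⁻¹ * ((Nat.totient (r / e) : ℕ) : ℝ)⁻¹) :=
              mul_le_mul_of_nonneg_left hinv hgT
      refine (Finset.sum_le_sum hle).trans ?_
      rw [← Finset.mul_sum, ← Finset.mul_sum]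
      refine mul_le_mul_of_nonneg_left (mul_le_mul_of_nonneg_left ?_
        (inv_nonneg.2 (Nat.cast_nonneg _))) hgT
      -- `∑_{r ∈ box, T ⊆ pf r} φ(r/e)⁻¹ ≤ S0` by the injection `r ↦ r / e` into `box`
      have hinj : Set.InjOn (fun r => r / e) ↑(box.filter (fun r => T ⊆ r.primeFactors)) := by
        intro r hr s hs hrs
        have hTr := (Finset.mem_filter.1 (Finset.mem_coe.1 hr)).2
        have hTs := (Finset.mem_filter.1 (Finset.mem_coe.1 hs)).2
        have her : e ∣ r := Finset.prod_primes_dvd r (fun p hp => (hTprime p hp).prime)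
          fun p hp => Nat.dvd_of_mem_primeFactors (hTr hp)
        have hes : e ∣ s := Finset.prod_primes_dvd s (fun p hp => (hTprime p hp).prime)
          fun p hp => Nat.dvd_of_mem_primeFactors (hTs hp)
        have h : r / e = s / e := hrs
        rw [← Nat.div_mul_cancel her, ← Nat.div_mul_cancel hes, h]
      have himg : (box.filter (fun r => T ⊆ r.primeFactors)).image (fun r => r / e) ⊆ box := by
        intro r' hr'
        obtain ⟨r, hr, rfl⟩ := Finset.mem_image.1 hr'
        obtain ⟨hrbox, hTr⟩ := Finset.mem_filter.1 hr
        have her : e ∣ r := Finset.prod_primes_dvd r (fun p hp => (hTprime p hp).prime)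
          fun p hp => Nat.dvd_of_mem_primeFactors (hTr hp)
        exact mem_box₀_of_dvd hrbox (Nat.div_dvd_of_dvd her)
      calc ∑ r ∈ box.filter (fun r => T ⊆ r.primeFactors), ((Nat.totient (r / e) : ℕ) : ℝ)⁻¹
          = ∑ r' ∈ (box.filter (fun r => T ⊆ r.primeFactors)).image (fun r => r / e),
              ((Nat.totient r' : ℕ) : ℝ)⁻¹ :=
            (Finset.sum_image (f := fun r' => ((Nat.totient r' : ℕ) : ℝ)⁻¹) hinj).symm
        _ ≤ S0 M R₀ := Finset.sum_le_sum_of_subset_of_nonneg himg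
              fun r _ _ => inv_nonneg.2 (Nat.cast_nonneg _)
    refine hsum.trans ?_
    -- `(∏ g) φ(e)⁻¹ ≤ ∏ g/(p-1)`
    have hφinv : ((Nat.totient e : ℕ) : ℝ)⁻¹ ≤ (∏ p ∈ T, ((p : ℝ) - 1))⁻¹ :=
      inv_anti₀ hprodpos hφe
    calc (∏ p ∈ T, g p) * (((Nat.totient e : ℕ) : ℝ)⁻¹ * S0 M R₀)
        ≤ (∏ p ∈ T, g p) * ((∏ p ∈ T, ((p : ℝ) - 1))⁻¹ * S0 M R₀) :=
          mul_le_mul_of_nonneg_left (mul_le_mul_of_nonneg_right hφinv S0_nonneg) hgT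
      _ = (∏ p ∈ T, g p / ((p : ℝ) - 1)) * S0 M R₀ := by
          rw [Finset.prod_div_distrib, div_eq_mul_inv]; ring
  refine (Finset.sum_le_sum hstep2).trans ?_
  rw [← Finset.sum_mul, mul_comm, ← Finset.prod_one_add]

end Basic

end Literature.NumberTheory.Sieve.SelbergBox
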